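/-
Copyright: the b2b-balaban T⁴-continuum CRUX team, row NE7b OWNER lineage `t4-ne7b-p1` (gen 123). Project licence.
-/
import Summits.QuantumFields.BalabanUV.T4Continuum.Spine.NE7b.SupTorusPerturbedPointwiseDecay
import Summits.QuantumFields.BalabanUV.T4Continuum.Spine.NE7b.SupTorusPerturbedCovariance

/-!
# THE POINTWISE COLUMN OF THE PERTURBED ROAD `H + K` ON THE CLASS `−λ ≤ V ≤ Λ`, `d ≥ 3`, BY NAME: the propagator `(H + K)⁻¹𝟙_{B_{y₀}}f`,
# the response `h^K_{y₀} = Σ_{y′}T_K⁻¹(y′,y₀)ψ^K_{y′}` and the fluctuation covariance `C_Kf = u − Σ_{y′}(T_K⁻¹Q′tu)(y′)ψ^K_{y′}` all satisfy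
# `e^{δρ_s(bt x, y₀)}·|·(x)| ≤ C(·M)` at EVERY site, for every SMALL exponentially local symmetric kernel (`γ > 1`, `εK_{γ−1} ≤
# (min(2,a) − λ)∕4`) — (174) `perturbed_pointwise_decay` read on the sources `𝟙_{B_{y₀}}f`, `T_K⁻¹(bt ·, y₀)` ((166)∕(168)) and
# `f − (T_K⁻¹Q′tu)∘bt` ((169) `perturbed_coeff_le`): (155) RE-RUN for `H + K`, i.e. the pointwise column is ITERABLE in the class of
# Hessians with a small local kernel perturbation (row NE7b, node U5c; (144)∕(155)∕(165)∕(166)∕(168)∕(169)∕(174) BY NAME; [folklore])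

Cell `pub-balaban`, sub-cell `t4`, spine estimate NE7b (`T4WeightBudget.RelWeightBound`; the cell's OWN estimate — NOT PRINTED in
[Bałaban 1983–89], NOT PROVED).  Crux-route work under `Spine/NE7b/` by the row OWNER (`t4-ne7b-p1` gen 123, file (175)) under FREEZE
(0)'s crux-prover clause; NOTHING of Bałaban's is named as a Lean object, valued or asserted; no `T4Continuum/Support` leaf typed; no `def`,
no notation (the action `(H + K)u` and every operator DISPLAYED exactly as in (162)–(174)); zero `sorry`.  Imports (BY NAME): the OWNER's
(174) `…SupTorusPerturbedPointwiseDecay` (`perturbed_pointwise_decay`; through it (168) `perturbed_response_local`,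
`perturbed_superposition_equation`, (166) `perturbed_nextScale_hessian_local`, (165) `perturbed_action_sub`, (144) `blockRMS_le_of_block_source`,
(132) `isPseudoDist_torus`, (131) `exists_rate`), (169) `…SupTorusPerturbedCovariance` (`perturbed_coeff_le`).

WHY (located).  (155) assembled the pointwise column of `H` on the road's class from (154); each object of the column of `H + K` is
likewise an `(H + K)⁻¹` of a source with an exponential sup profile: a block source (any rate); the response's source `T_K⁻¹(bt ·, y₀)`
((168), profile `c₁e^{−δ₁ρ_s}` by (166)); the fluctuation part's source `f − c∘bt`, `c = T_K⁻¹(Q′tu)` ((169) `perturbed_coeff_le`,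
profile `(1 + c₁(m_κ − εK_{γ−κ})⁻¹e^{2dκ}K)M·e^{−δ′ρ_s}`; the displays of `u − h` by (165) `perturbed_action_sub` and (168)
`perturbed_superposition_equation`) — and (174) converts each profile into the solution's, with the weight on the left.

WHAT IS PROVED ([folklore]; fine torus `Site d ((n+1)s)`, coarse `Site d s`, `[NeZero s]`; `(H + K)u` DISPLAYED; `σ = siteOf`, `bt x =
σ_s(blk n (wm x))`, `ρ_s` the `ℓ¹` circular distance; `T_K = Matrix.of (y,y″ ↦ (n+1)^{−d}Σ_z ψ^K_{y″}(σ(chart (wm y) z)))`; throughout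
`d ≥ 3`, `a > 0`, `λ < min(2,a)`, `Λ ≥ 0`, `ε ≥ 0`, `γ > 1`, `εK_{γ−1} ≤ (min(2,a) − λ)∕4`, conclusions for ALL `n, s`, ALL `−λ ≤ V ≤ Λ`, ALL
kernels `|K(x,z)| ≤ εe^{−γρ_N(x,z)}` (symmetric in §2–§3), with `∃ C δ > 0` functions of `(d, a, λ, Λ, ε, γ)` and `C(d)` only):
* §1 **`perturbed_propagator_pointwise_decay`**: `f` supported in the block `y₀`, `|f| ≤ M`, `(H + K)u = f` ⟹ `e^{δρ_s(bt x, y₀)}·|u x| ≤ C·M`.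
* §2 **`perturbed_response_pointwise_decay`**: block columns `ψ^K` ⟹ `e^{δρ_s(bt x, y₀)}·|Σ_{y′}T_K⁻¹(y′,y₀)ψ^K_{y′}(x)| ≤ C` every `y₀, x`.
* §3 **`perturbed_covariance_pointwise_decay`**: block columns `ψ^K`, `f` supported in `y₀`, `|f| ≤ M`, `(H + K)u = f` ⟹
  `e^{δρ_s(bt x, y₀)}·|u x − Σ_{y′}(Σ_{y″}T_K⁻¹(y′,y″)(n+1)^{−d}Σ_z u(σ(chart (wm y″) z)))ψ^K_{y′}(x)| ≤ C·M` every `x`.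
* §4 toy (`d = 3`).

HONEST (what this is NOT).  By-name junctions only (the analysis is (173)∕(174)); `d ≥ 3` only; constants existential and far from sharp;
SMALL kernels with the exact lattice Laplacian as main part (the O(1) coarse kernel ∕ non-Laplacian main part of the road's own next
Hessian is NOT covered); cubic periods; scalar skeleton ((A3), NC-NE7b-α UNRULED); nothing of the covariant propagators of [B4]–[B6];
nothing of Bałaban's.  BY-NAME EFFECT ON THE WALL: NONE.  NE7b NOT PRINTED ∕ NOT PROVED; spine PROVED 0∕9; rung (B)+1 on a FINITE torus —
NOT infinite volume, NOT the mass gap, NOT Clay.  HONEST DEPENDENCY: continuum YM on T⁴ ⇐ BetaPertH ∧ nine spine estimates (0∕9 proved);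
BetaPertH ⇐ (D1) ∧ (D4) ∧ CAP+tail; G-an2-4 gates asym, D1 and NE2∕3∕4.
-/

set_option autoImplicit false

noncomputable section

namespace Summit.QuantumFields.BalabanUV.T4Continuum.NE7b.SupTorusPerturbedPointwiseColumn

open Real
open Literature.MathematicalPhysics.QuantumFieldTheory.Balaban1983to89
open B6QGQLower276 (X e blk B side chart mem_B sum_B sum_B_const card_cube blk_chart)
open Beta (Site siteOf windowMap siteOf_windowMap siteOf_add siteOf_sub)
open SupTorusHessianCombesThomas (exists_rate)
open SupTorusBlockDistance (isPseudoDist_torus)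
open SupTorusMaximumPrinciple (blockRMS_le_of_block_source)
open SupTorusPerturbedColumns (perturbed_action_sub)
open SupTorusPerturbedCoarseFloor (perturbed_nextScale_hessian_local)
open SupTorusPerturbedResponse (kernelSum_anti perturbed_superposition_equation perturbed_response_local)
open SupTorusPerturbedCovariance (perturbed_coeff_le)
open SupTorusPerturbedPointwiseDecay (perturbed_pointwise_decay)

variable {d : ℕ}

/-! ## §1. The perturbed propagator of a block source, pointwise -/

/-- **`e^{δρ_s(bt x, y₀)}·|(H_V + K)⁻¹f|(x) ≤ C·‖f‖_∞` ON THE ROAD'S CLASS `−λ ≤ V ≤ Λ`, `d ≥ 3`, every mesh, every volume, every small local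
kernel**, for `f` supported in the block `y₀` — (174) `perturbed_pointwise_decay` at the profile rate `γ′ = 1` (a block source has every
profile). [folklore] -/
theorem perturbed_propagator_pointwise_decay (hd : 3 ≤ d) (a : ℝ) (ha : 0 < a) {lam Lam ε γ : ℝ} (hlam : lam < min 2 a)
    (hLam : 0 ≤ Lam) (hε : 0 ≤ ε) (hγ : 1 < γ) (hεs : ε * (2 * (1 - exp (-(γ - 1)))⁻¹) ^ d ≤ (min 2 a - lam) / 4) :
    ∃ C δ : ℝ, 0 < C ∧ 0 < δ ∧ ∀ (n s : ℕ) [NeZero s] (V : Site d ((n + 1) * s) → ℝ), (∀ x, -lam ≤ V x) → (∀ x, V x ≤ Lam) →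
      ∀ K : Site d ((n + 1) * s) → Site d ((n + 1) * s) → ℝ,
      (∀ x z, |K x z| ≤ ε * exp (-(γ * ∑ i, (((x i - z i).valMinAbs.natAbs : ℕ) : ℝ)))) →
      ∀ (y₀ : Site d s) (M : ℝ) (u f : Site d ((n + 1) * s) → ℝ), (∀ x, siteOf d s (blk n (windowMap d ((n + 1) * s) x)) ≠ y₀ → f x = 0) →
      (∀ x, |f x| ≤ M) →
      (∀ x, ((n : ℝ) + 1) ^ 2 * ∑ μ, (2 * u x - u (x + siteOf d ((n + 1) * s) (e μ)) - u (x - siteOf d ((n + 1) * s) (e μ)))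
        + a / ((n : ℝ) + 1) ^ d * ∑ q ∈ B n (blk n (windowMap d ((n + 1) * s) x)), u (siteOf d ((n + 1) * s) q) + V x * u x
        + ∑ z, K x z * u z = f x) →
      ∀ x : Site d ((n + 1) * s),
        exp (δ * ∑ i, ((((siteOf d s (blk n (windowMap d ((n + 1) * s) x))) i - y₀ i).valMinAbs.natAbs : ℕ) : ℝ)) * |u x| ≤ C * M := by
  obtain ⟨C, δ, hC, hδ, H⟩ := perturbed_pointwise_decay (d := d) hd a ha hlam hLam one_pos hε hγ hεs
  refine ⟨C, δ, hC, hδ, fun n s _ V hV hV' K hK y₀ M u f hf hfM hu x => H n s V hV hV' K hK y₀ M u f (fun x' => ?_) hu x⟩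
  have hM : 0 ≤ M := (abs_nonneg _).trans (hfM x')
  by_cases hx : siteOf d s (blk n (windowMap d ((n + 1) * s) x')) = y₀
  · rw [hx, (isPseudoDist_torus (d := d) s).zero y₀, mul_zero, neg_zero, exp_zero, mul_one]; exact hfM x'
  · rw [hf x' hx, abs_zero]; positivity

/-! ## §2. The perturbed response, pointwise -/

/-- **`e^{δρ_s(bt x, y₀)}·|h^K_{y₀}(x)| ≤ C` ON THE ROAD'S CLASS, `d ≥ 3`, every mesh, every volume, every small local symmetric kernel**, for
the response `h^K_{y₀} = Σ_{y′}T_K⁻¹(y′,y₀)ψ^K_{y′}` of the block columns `ψ^K` of `H + K`: `(H + K)h^K_{y₀} = T_K⁻¹(bt ·, y₀)` ((168)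
`perturbed_response_local`), a source with the profile `c₁e^{−δ₁ρ_s(bt ·, y₀)}` ((166) `perturbed_nextScale_hessian_local`), so (174)
applies. [folklore] -/
theorem perturbed_response_pointwise_decay (hd : 3 ≤ d) (a : ℝ) (ha : 0 < a) {lam Lam ε γ : ℝ} (hlam : lam < min 2 a)
    (hLam : 0 ≤ Lam) (hε : 0 ≤ ε) (hγ : 1 < γ) (hεs : ε * (2 * (1 - exp (-(γ - 1)))⁻¹) ^ d ≤ (min 2 a - lam) / 4) :
    ∃ C δ : ℝ, 0 < C ∧ 0 < δ ∧ ∀ (n s : ℕ) [NeZero s] (V : Site d ((n + 1) * s) → ℝ), (∀ x, -lam ≤ V x) → (∀ x, V x ≤ Lam) →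
      ∀ K : Site d ((n + 1) * s) → Site d ((n + 1) * s) → ℝ, (∀ x z, K x z = K z x) →
      (∀ x z, |K x z| ≤ ε * exp (-(γ * ∑ i, (((x i - z i).valMinAbs.natAbs : ℕ) : ℝ)))) →
      ∀ ψ : Site d s → Site d ((n + 1) * s) → ℝ,
      (∀ y' x, ((n : ℝ) + 1) ^ 2 * ∑ μ, (2 * ψ y' x - ψ y' (x + siteOf d ((n + 1) * s) (e μ)) - ψ y' (x - siteOf d ((n + 1) * s) (e μ)))
        + a / ((n : ℝ) + 1) ^ d * ∑ q ∈ B n (blk n (windowMap d ((n + 1) * s) x)), ψ y' (siteOf d ((n + 1) * s) q) + V x * ψ y' x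
        + ∑ z, K x z * ψ y' z = if siteOf d s (blk n (windowMap d ((n + 1) * s) x)) = y' then 1 else 0) →
      ∀ (y₀ : Site d s) (x : Site d ((n + 1) * s)),
        exp (δ * ∑ i, ((((siteOf d s (blk n (windowMap d ((n + 1) * s) x))) i - y₀ i).valMinAbs.natAbs : ℕ) : ℝ))
          * |∑ y', (Matrix.of fun yy y'' : Site d s =>
            (((n : ℝ) + 1) ^ d)⁻¹ * ∑ z : Fin d → Fin (n + 1), ψ y'' (siteOf d ((n + 1) * s) (chart n (windowMap d s yy) z)))⁻¹ y' y₀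
            * ψ y' x| ≤ C := by
  classical
  have hm0 : 0 < min 2 a - lam := by linarith
  obtain ⟨c₁, δ₁, hc₁, hδ₁, H166⟩ := perturbed_nextScale_hessian_local (d := d) a ha hm0 hLam hε hγ hεs
  obtain ⟨C8, δ8, -, -, H168⟩ := perturbed_response_local (d := d) a ha hm0 hLam hε hγ hεs
  obtain ⟨C, δ, hC, hδ, H⟩ := perturbed_pointwise_decay (d := d) hd a ha hlam hLam hδ₁ hε hγ hεs
  refine ⟨C * c₁, δ, by positivity, hδ, ?_⟩
  intro n s _ V hV hV' K hKs hK ψ hψ y₀ x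
  set T : Matrix (Site d s) (Site d s) ℝ := Matrix.of fun yy y'' : Site d s =>
    (((n : ℝ) + 1) ^ d)⁻¹ * ∑ z : Fin d → Fin (n + 1), ψ y'' (siteOf d ((n + 1) * s) (chart n (windowMap d s yy) z)) with hT_def
  obtain ⟨-, hH, -⟩ := H168 n s V hV hV' K hKs hK ψ hψ y₀
  have hsrc : ∀ x' : Site d ((n + 1) * s), |T⁻¹ (siteOf d s (blk n (windowMap d ((n + 1) * s) x'))) y₀|
      ≤ c₁ * exp (-(δ₁ * ∑ i, ((((siteOf d s (blk n (windowMap d ((n + 1) * s) x'))) i - y₀ i).valMinAbs.natAbs : ℕ) : ℝ))) :=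
    fun x' => H166 n s V hV hV' K hKs hK ψ hψ _ y₀
  have h := H n s V hV hV' K hK y₀ c₁ (fun x' => ∑ y', T⁻¹ y' y₀ * ψ y' x')
    (fun x' => T⁻¹ (siteOf d s (blk n (windowMap d ((n + 1) * s) x'))) y₀) hsrc hH x
  linarith [h]

/-! ## §3. The perturbed fluctuation covariance, pointwise -/

/-- **`e^{δρ_s(bt x, y₀)}·|C_Kf|(x) ≤ C·‖f‖_∞` ON THE ROAD'S CLASS, `d ≥ 3`, every mesh, every volume, every small local symmetric kernel**: for
the block columns `ψ^K`, `(H + K)u = f` with `f` supported in the block `y₀`, `|f| ≤ M`, the fluctuation part `u − h`, `h = Σ_{y′}c y′·ψ^K_{y′}`,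
`c = T_K⁻¹(Q′tu)`, has `(H + K)(u − h) = f − c∘bt` ((165) `perturbed_action_sub`, (168) `perturbed_superposition_equation`) with `|c y′| ≤
c₁(m_κ − εK_{γ−κ})⁻¹e^{2dκ}K·M·e^{−δ′ρ_s(y′,y₀)}` ((169) `perturbed_coeff_le`, (144) `blockRMS_le_of_block_source`), a source with the profile
`(1 + c₁(m_κ − εK_{γ−κ})⁻¹e^{2dκ}K)M·e^{−δ′ρ_s}`, so (174) applies. [folklore] -/
theorem perturbed_covariance_pointwise_decay (hd : 3 ≤ d) (a : ℝ) (ha : 0 < a) {lam Lam ε γ : ℝ} (hlam : lam < min 2 a)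
    (hLam : 0 ≤ Lam) (hε : 0 ≤ ε) (hγ : 1 < γ) (hεs : ε * (2 * (1 - exp (-(γ - 1)))⁻¹) ^ d ≤ (min 2 a - lam) / 4) :
    ∃ C δ : ℝ, 0 < C ∧ 0 < δ ∧ ∀ (n s : ℕ) [NeZero s] (V : Site d ((n + 1) * s) → ℝ), (∀ x, -lam ≤ V x) → (∀ x, V x ≤ Lam) →
      ∀ K : Site d ((n + 1) * s) → Site d ((n + 1) * s) → ℝ, (∀ x z, K x z = K z x) →
      (∀ x z, |K x z| ≤ ε * exp (-(γ * ∑ i, (((x i - z i).valMinAbs.natAbs : ℕ) : ℝ)))) →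
      ∀ ψ : Site d s → Site d ((n + 1) * s) → ℝ,
      (∀ y' x, ((n : ℝ) + 1) ^ 2 * ∑ μ, (2 * ψ y' x - ψ y' (x + siteOf d ((n + 1) * s) (e μ)) - ψ y' (x - siteOf d ((n + 1) * s) (e μ)))
        + a / ((n : ℝ) + 1) ^ d * ∑ q ∈ B n (blk n (windowMap d ((n + 1) * s) x)), ψ y' (siteOf d ((n + 1) * s) q) + V x * ψ y' x
        + ∑ z, K x z * ψ y' z = if siteOf d s (blk n (windowMap d ((n + 1) * s) x)) = y' then 1 else 0) →
      ∀ (y₀ : Site d s) (M : ℝ) (u f : Site d ((n + 1) * s) → ℝ), (∀ x, siteOf d s (blk n (windowMap d ((n + 1) * s) x)) ≠ y₀ → f x = 0) →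
      (∀ x, |f x| ≤ M) →
      (∀ x, ((n : ℝ) + 1) ^ 2 * ∑ μ, (2 * u x - u (x + siteOf d ((n + 1) * s) (e μ)) - u (x - siteOf d ((n + 1) * s) (e μ)))
        + a / ((n : ℝ) + 1) ^ d * ∑ q ∈ B n (blk n (windowMap d ((n + 1) * s) x)), u (siteOf d ((n + 1) * s) q) + V x * u x
        + ∑ z, K x z * u z = f x) →
      ∀ x : Site d ((n + 1) * s),
        exp (δ * ∑ i, ((((siteOf d s (blk n (windowMap d ((n + 1) * s) x))) i - y₀ i).valMinAbs.natAbs : ℕ) : ℝ))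
          * |u x - ∑ y', (∑ y'', (Matrix.of fun yy y'' : Site d s =>
              (((n : ℝ) + 1) ^ d)⁻¹ * ∑ z : Fin d → Fin (n + 1), ψ y'' (siteOf d ((n + 1) * s) (chart n (windowMap d s yy) z)))⁻¹ y' y''
            * ((((n : ℝ) + 1) ^ d)⁻¹ * ∑ z'' : Fin d → Fin (n + 1), u (siteOf d ((n + 1) * s) (chart n (windowMap d s y'') z''))))
            * ψ y' x| ≤ C * M := by
  classical
  have hdR : (0 : ℝ) ≤ d := Nat.cast_nonneg d
  have hm0 : 0 < min 2 a - lam := by linarith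
  obtain ⟨κ, hκ0, hκ1, hκm⟩ := exists_rate (d := d) a ha.le hm0
  have hκγ : κ < γ := lt_of_le_of_lt hκ1 hγ
  -- the perturbed floor at the rate `κ`: `εK_{γ−κ} ≤ εK_{γ−1} ≤ (min(2,a) − λ)∕4 < m_κ`
  have hKmono : (2 * (1 - exp (-(γ - κ)))⁻¹) ^ d ≤ (2 * (1 - exp (-(γ - 1)))⁻¹) ^ d :=
    kernelSum_anti (d := d) (by linarith) (by linarith)
  have hεκ : ε * (2 * (1 - exp (-(γ - κ)))⁻¹) ^ d ≤ (min 2 a - lam) / 4 := (mul_le_mul_of_nonneg_left hKmono hε).trans hεs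
  have hm : ε * (2 * (1 - exp (-(γ - κ)))⁻¹) ^ d < min 2 a - lam - 2 * d * κ ^ 2 - a * (exp (2 * d * κ) - 1) := by linarith
  set m := min 2 a - lam - 2 * d * κ ^ 2 - a * (exp (2 * d * κ) - 1) - ε * (2 * (1 - exp (-(γ - κ)))⁻¹) ^ d with hm_def
  have hmpos : 0 < m := by rw [hm_def]; linarith
  have hminv : 0 ≤ m⁻¹ := inv_nonneg.2 hmpos.le
  obtain ⟨c₁, δ₁, hc₁, hδ₁, H166⟩ := perturbed_nextScale_hessian_local (d := d) a ha hm0 hLam hε hγ hεs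
  set δ' : ℝ := min δ₁ (κ / 2) with hδ'_def
  have hδ'0 : 0 < δ' := lt_min hδ₁ (by linarith)
  have hδ'δ₁ : δ' ≤ δ₁ := min_le_left _ _
  have h2δ' : 2 * δ' ≤ κ := by have := min_le_right δ₁ (κ / 2); rw [← hδ'_def] at this; linarith
  set Kδ : ℝ := (2 * (1 - exp (-δ'))⁻¹) ^ d with hKδ
  have hKδ0 : 0 ≤ Kδ := pow_nonneg (mul_nonneg zero_le_two (inv_nonneg.2 (sub_nonneg.2 (exp_le_one_iff.2 (by linarith))))) d
  obtain ⟨C, δ, hC, hδ, H⟩ := perturbed_pointwise_decay (d := d) hd a ha hlam hLam hδ'0 hε hγ hεs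
  refine ⟨C * (1 + c₁ * (m⁻¹ * exp (2 * d * κ)) * Kδ), δ, by positivity, hδ, ?_⟩
  intro n s _ V hV hV' K hKs hK ψ hψ y₀ M u f hf hfM hu x
  set T : Matrix (Site d s) (Site d s) ℝ := Matrix.of fun yy y'' : Site d s =>
    (((n : ℝ) + 1) ^ d)⁻¹ * ∑ z : Fin d → Fin (n + 1), ψ y'' (siteOf d ((n + 1) * s) (chart n (windowMap d s yy) z)) with hT_def
  have hM : 0 ≤ M := (abs_nonneg _).trans (hfM x)
  have hTinv : ∀ y y' : Site d s, |T⁻¹ y y'| ≤ c₁ * exp (-(δ₁ * ∑ i, (((y i - y' i).valMinAbs.natAbs : ℕ) : ℝ))) :=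
    fun y y' => H166 n s V hV hV' K hKs hK ψ hψ y y'
  set cc : Site d s → ℝ := fun y' => ∑ y'', T⁻¹ y' y''
    * ((((n : ℝ) + 1) ^ d)⁻¹ * ∑ z'' : Fin d → Fin (n + 1), u (siteOf d ((n + 1) * s) (chart n (windowMap d s y'') z''))) with hcc
  set hfl : Site d ((n + 1) * s) → ℝ := fun x => ∑ y', cc y' * ψ y' x with hhfl
  have hR := blockRMS_le_of_block_source n s y₀ f hf hfM
  -- the coefficients decay like the source block's distance
  have hcoef : ∀ y', |cc y'| ≤ c₁ * (m⁻¹ * exp (2 * d * κ)) * Kδ * M * exp (-(δ' * ∑ i, (((y' i - y₀ i).valMinAbs.natAbs : ℕ) : ℝ))) := by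
    intro y'
    refine (perturbed_coeff_le n a s V K (fun y' y'' => T⁻¹ y' y'') u ha.le hκ0.le hκ1 hκγ hε hm hδ'0 hδ'δ₁ h2δ' hc₁.le hV hK
      hTinv y₀ f hf hu y').trans ?_
    have hE := exp_pos (-(δ' * ∑ i, (((y' i - y₀ i).valMinAbs.natAbs : ℕ) : ℝ)))
    have : c₁ * (m⁻¹ * exp (2 * d * κ) * √((((n : ℝ) + 1) ^ d)⁻¹ * ∑ x, f x ^ 2)) * Kδ ≤ c₁ * (m⁻¹ * exp (2 * d * κ) * M) * Kδ :=
      mul_le_mul_of_nonneg_right (mul_le_mul_of_nonneg_left (mul_le_mul_of_nonneg_left hR (by positivity)) hc₁.le) hKδ0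
    calc c₁ * (m⁻¹ * exp (2 * d * κ) * √((((n : ℝ) + 1) ^ d)⁻¹ * ∑ x, f x ^ 2)) * Kδ
          * exp (-(δ' * ∑ i, (((y' i - y₀ i).valMinAbs.natAbs : ℕ) : ℝ)))
        ≤ c₁ * (m⁻¹ * exp (2 * d * κ) * M) * Kδ * exp (-(δ' * ∑ i, (((y' i - y₀ i).valMinAbs.natAbs : ℕ) : ℝ))) :=
          mul_le_mul_of_nonneg_right this hE.le
      _ = _ := by ring
  -- the displays of `u − hfl`: `(H + K)(u − hfl) = f − cc∘bt`
  have hHfl : ∀ x', ((n : ℝ) + 1) ^ 2 * ∑ μ, (2 * hfl x' - hfl (x' + siteOf d ((n + 1) * s) (e μ)) - hfl (x' - siteOf d ((n + 1) * s) (e μ)))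
      + a / ((n : ℝ) + 1) ^ d * ∑ q ∈ B n (blk n (windowMap d ((n + 1) * s) x')), hfl (siteOf d ((n + 1) * s) q) + V x' * hfl x'
      + ∑ z, K x' z * hfl z = cc (siteOf d s (blk n (windowMap d ((n + 1) * s) x'))) :=
    fun x' => perturbed_superposition_equation n a s V K ψ hψ cc x'
  have hdiff : ∀ x', ((n : ℝ) + 1) ^ 2 * ∑ μ, (2 * (u x' - hfl x') - (u (x' + siteOf d ((n + 1) * s) (e μ)) - hfl (x' + siteOf d ((n + 1) * s) (e μ)))
        - (u (x' - siteOf d ((n + 1) * s) (e μ)) - hfl (x' - siteOf d ((n + 1) * s) (e μ))))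
      + a / ((n : ℝ) + 1) ^ d * ∑ q ∈ B n (blk n (windowMap d ((n + 1) * s) x')), (u (siteOf d ((n + 1) * s) q) - hfl (siteOf d ((n + 1) * s) q))
      + V x' * (u x' - hfl x') + ∑ z, K x' z * (u z - hfl z) = f x' - cc (siteOf d s (blk n (windowMap d ((n + 1) * s) x'))) := by
    intro x'; rw [perturbed_action_sub n a s V K u hfl x', hu x', hHfl x']
  -- the source `f − cc∘bt` has the profile `(1 + c₁m⁻¹e^{2dκ}K)M·e^{−δ′ρ_s(bt ·, y₀)}`
  have hsrc : ∀ x', |f x' - cc (siteOf d s (blk n (windowMap d ((n + 1) * s) x')))|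
      ≤ (1 + c₁ * (m⁻¹ * exp (2 * d * κ)) * Kδ) * M
        * exp (-(δ' * ∑ i, ((((siteOf d s (blk n (windowMap d ((n + 1) * s) x'))) i - y₀ i).valMinAbs.natAbs : ℕ) : ℝ))) := by
    intro x'
    have hc := hcoef (siteOf d s (blk n (windowMap d ((n + 1) * s) x')))
    have hE := exp_pos (-(δ' * ∑ i, ((((siteOf d s (blk n (windowMap d ((n + 1) * s) x'))) i - y₀ i).valMinAbs.natAbs : ℕ) : ℝ)))
    have hfx : |f x'| ≤ M * exp (-(δ' * ∑ i, ((((siteOf d s (blk n (windowMap d ((n + 1) * s) x'))) i - y₀ i).valMinAbs.natAbs : ℕ) : ℝ))) := by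
      by_cases hx : siteOf d s (blk n (windowMap d ((n + 1) * s) x')) = y₀
      · rw [hx, (isPseudoDist_torus (d := d) s).zero y₀, mul_zero, neg_zero, exp_zero, mul_one]; exact hfM x'
      · rw [hf x' hx, abs_zero]; positivity
    calc |f x' - cc (siteOf d s (blk n (windowMap d ((n + 1) * s) x')))|
        ≤ |f x'| + |cc (siteOf d s (blk n (windowMap d ((n + 1) * s) x')))| := abs_sub _ _
      _ ≤ M * exp (-(δ' * ∑ i, ((((siteOf d s (blk n (windowMap d ((n + 1) * s) x'))) i - y₀ i).valMinAbs.natAbs : ℕ) : ℝ)))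
          + c₁ * (m⁻¹ * exp (2 * d * κ)) * Kδ * M
          * exp (-(δ' * ∑ i, ((((siteOf d s (blk n (windowMap d ((n + 1) * s) x'))) i - y₀ i).valMinAbs.natAbs : ℕ) : ℝ))) := add_le_add hfx hc
      _ = _ := by ring
  have h := H n s V hV hV' K hK y₀ ((1 + c₁ * (m⁻¹ * exp (2 * d * κ)) * Kδ) * M) (fun x' => u x' - hfl x')
    (fun x' => f x' - cc (siteOf d s (blk n (windowMap d ((n + 1) * s) x')))) hsrc hdiff x
  simp only [hhfl, hcc] at h
  linarith [h]

/-! ## §4. Toy -/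

/-- Toy (`d = 3`, `a = 1`, `λ = 0`, `Λ = 1`, `ε = 0`, `γ = 2`): the constants of the perturbed response's pointwise letter exist. -/
example : ∃ C δ : ℝ, 0 < C ∧ 0 < δ :=
  let ⟨C, δ, hC, hδ, _⟩ := perturbed_response_pointwise_decay (d := 3) le_rfl 1 one_pos (lam := 0) (Lam := 1) (ε := 0) (γ := 2)
    (by rw [min_eq_right (by norm_num : (1 : ℝ) ≤ 2)]; norm_num) zero_le_one le_rfl (by norm_num)
    (by rw [min_eq_right (by norm_num : (1 : ℝ) ≤ 2)]; norm_num)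
  ⟨C, δ, hC, hδ⟩

end Summit.QuantumFields.BalabanUV.T4Continuum.NE7b.SupTorusPerturbedPointwiseColumn
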